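import Mathlib
import HarnessLib
import Summits.HubbardSuperconductivity.HubbardSuperconductivity.Theorems.KLProgrammeLatticeSoftBubbleSharpTCCells

/-!
# Route `KLProgramme` — ENGINE stmt-HubbardSuperconductivity-20437 `KLRegimeEngineV17F2`, row (c) value lane / class-#5 STEP (X).3 pinned pair: the lattice forward / SOFT slice bubble
# (sharp-TC) with per-ray quasi-Lipschitz weight data ASKED ONLY INSIDE THE SQUARE (brick (L3)-3′ of cure (A″) route 3′ of located «(c)-OUT-COOPER-ANTIPODE»; cell
# gate-hubbard-kl, seat hubbard-kl-k3c2-p2 g26, technique «thermal-bar induction n ≤ nScales β + 1 with EngineBoundsAtV4S sums»)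

WHY.  `klfl_lattice_*TC_cells` (…LatticeSoftBubbleSharpTCCells) ask the per-ray quasi-Lipschitz datum of the periodic weight `a` for EVERY ray point of the tube `|band| < 4Λₙ`,
`t ≥ 0` — including the periodic images of the tube far out on the ray (`t > π/‖dir θ‖`), where a CELL of lattice data says nothing (the McShane extension carries only its
global constant there).  Those points are irrelevant: the planar weight of the lattice lemma is `a·ψ_zm` with the square cut `ψ_zm = 0` off `(−(π−zm), π−zm)²`.  This file restates
the two lattice lemmas with the datum asked only for `θ ∈ (−π, π)` and ray points INSIDE THE OPEN SQUARE (both `|t cos θ|, |t sin θ| < π`); off the cut's support the difference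
`A(p) − A(q)` is `≤ A₀·(2/zm)·|t − t'|` by `ψ`'s Lipschitz constant alone.  This is the form the CELL → RAY geometry (next brick) supplies.
* `klfs_planar_bubble_norm_le_of_lipschitzTCQ_Ioo` (the planar lemma with data asked only for `θ ∈ (−π, π)`);
* **`klfl_lattice_forward_bubble_norm_le_of_lipschitzTC_cellsSq`**, **`klfl_lattice_soft_bubble_norm_leTC_cellsSq`**.
Pure analysis on the tree's objects; nothing about the model is asserted; nothing asserts (X).3, (c), K3 or superconductivity.
References: BGM 2006 §2.4–2.5 [cite: BenfattoGiulianiMastropietro2006]; FST 1998 App. B [cite: FeldmanSalmhoferTrubowitz1998].  0 kit · 0 lit.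
-/

noncomputable section

namespace Summit.HubbardSuperconductivity.HubbardSuperconductivity.Theorems.KLRegimeSplit

set_option linter.dupNamespace false -- summit = problem name (single-conjunct summit), D-0017

open Real Set Filter MeasureTheory Complex Literature.MathematicalPhysics.QuantumLattice Literature.Probability.LatticeModels
open Literature.MathematicalPhysics.QuantumLattice.BandSectorCounting
open Summit.HubbardSuperconductivity.HubbardSuperconductivity.Theorems.PerturbedFermiCurve
open Summit.HubbardSuperconductivity.HubbardSuperconductivity.Theorems.KLProgrammeLegKernels
open Summit.HubbardSuperconductivity.HubbardSuperconductivity.Theorems.DispersionFlow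
open scoped NNReal

/-! ## §1 The planar lemma with data asked only for `θ ∈ (−π, π)` -/

section Frame
variable {a b : ℝ} (B : BandBounds a b) {δ : (Fin 2 → ℝ) → ℝ} (hδ1 : ContDiff ℝ 1 δ) {κ₀ κ₁ : ℝ}
  (hδ : ∀ k : Fin 2 → ℝ, (∀ i, |k i| ≤ π) → |δ k| ≤ κ₀)
  (hκ : ∀ k : Fin 2 → ℝ, (∀ i, |k i| ≤ π) → ‖fderiv ℝ δ k‖ ≤ κ₁) (hκ₁ : κ₁ < B.Dtmin)

include B hδ1 hδ hκ hκ₁ in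
/-- **`klfs_planar_bubble_norm_le_of_lipschitzTCQ` with the per-ray data asked only for `θ ∈ (−π, π)`** (the angles the coarea formula integrates over). -/
theorem klfs_planar_bubble_norm_le_of_lipschitzTCQ_Ioo {A : ℝ × ℝ → ℂ} (hA : Continuous A) (hAsupp : ∀ p : ℝ × ℝ, A p ≠ 0 → |p.1| < π ∧ |p.2| < π)
    {n : ℕ} {μ : ℝ} {A₀ A₁ δA : ℝ → ℝ} (hA0' : ∀ θ, 0 ≤ A₀ θ) (hA1' : ∀ θ, 0 ≤ A₁ θ) (hδA' : ∀ θ, 0 ≤ δA θ)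
    (hA0i : IntegrableOn A₀ (Ioo (-π) π)) (hA1i : IntegrableOn A₁ (Ioo (-π) π)) (hδAi : IntegrableOn δA (Ioo (-π) π))
    (hA0 : ∀ θ ∈ Ioo (-π) π, ∀ t : ℝ, 0 ≤ t → |klfb_band δ μ (t * Real.cos θ, t * Real.sin θ)| < 4 * klScale klE0 n →
      ‖A (t * Real.cos θ, t * Real.sin θ)‖ ≤ A₀ θ)
    (hA1 : ∀ θ ∈ Ioo (-π) π, ∀ t t' : ℝ, 0 ≤ t → 0 ≤ t' → |klfb_band δ μ (t * Real.cos θ, t * Real.sin θ)| < 4 * klScale klE0 n →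
      |klfb_band δ μ (t' * Real.cos θ, t' * Real.sin θ)| < 4 * klScale klE0 n →
      ‖A (t * Real.cos θ, t * Real.sin θ) - A (t' * Real.cos θ, t' * Real.sin θ)‖ ≤ A₁ θ * |t - t'| + δA θ)
    {κ₂ : ℝ} (hκ₂ : 0 ≤ κ₂)
    (hD2 : ∀ θ s t : ℝ, s ∈ Icc 0 (π / ‖dir θ‖) → t ∈ Icc 0 (π / ‖dir θ‖) →
      |fderiv ℝ δ (s • dir θ) (dir θ) - fderiv ℝ δ (t • dir θ) (dir θ)| ≤ κ₂ * |s - t|)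
    {f f' : ℝ → ℂ} {Lf Mf K' LF MF ℓ : ℝ}
    (hlip : ∀ s s', ‖f s - f s'‖ ≤ Lf * |s - s'|) (hbd : ∀ s, ‖f s‖ ≤ Mf)
    (hin : ∀ s, s ≤ (klScale klE0 n / 2) ^ 2 → f s = 0) (hout : ∀ s, (4 * klScale klE0 n) ^ 2 ≤ s → f s = 0)
    (hK' : 0 ≤ K') (hΨlip : ∀ k₀ e k₀' e', ‖klfb_prop f' k₀ e - klfb_prop f' k₀' e'‖ ≤ K' * (|k₀ - k₀'| + |e - e'|))
    (hMF : 0 ≤ MF) (hFlip : ∀ s s', ‖f s * f' s - f s' * f' s'‖ ≤ LF * |s - s'|) (hFbd : ∀ s, ‖f s * f' s‖ ≤ MF)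
    (hLF : LF ≤ ℓ / klScale klE0 n ^ 2)
    {e' : ℝ × ℝ → ℝ} (he' : Continuous e') {δmax : ℝ} (hδ0 : 0 ≤ δmax)
    (he'δ : ∀ p : ℝ × ℝ, |p.1| < π → |p.2| < π → |e' p - klfb_band δ μ p| ≤ δmax)
    (hlo : a < μ - 4 * klScale klE0 n - κ₀) (hhi : μ + 4 * klScale klE0 n + κ₀ < b)
    (q₀ : ℝ) {β : ℝ} (hβ : klBetaMin ≤ β) (hn : n ≤ nScales β + 1) {M : ℕ}
    (hM : β * (4 * klScale klE0 n) / (2 * Real.pi) + 1 ≤ M) :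
    ‖β⁻¹ • ∑ i : MatsubaraIdx M, ∫ p : ℝ × ℝ, klfb_integrand δ μ A f f' e' (matsubaraFreq β M i) q₀ p‖ ≤
      ∫ θ in Ioo (-π) π,
        (64 / Real.pi * MF *
            (Real.pi * Real.sqrt 2 / (B.Dtmin - κ₁) * A₁ θ / (B.Dtmin - κ₁) +
              A₀ θ * (1 / (B.Dtmin - κ₁) ^ 2 + Real.pi * Real.sqrt 2 * (2 + κ₂) / (B.Dtmin - κ₁) ^ 3)) * klScale klE0 n +
          128 / Real.pi * MF * (Real.pi * Real.sqrt 2 / (B.Dtmin - κ₁) * δA θ) +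
          393216 / Real.pi * (ℓ + 8 * MF) * (A₀ θ * (Real.pi * Real.sqrt 2 / (B.Dtmin - κ₁))) * ((Real.pi / β) / klScale klE0 n) +
            (64 / Real.pi * Mf * (A₀ θ * (Real.pi * Real.sqrt 2 / (B.Dtmin - κ₁))) * (K' * klScale klE0 n) * (|q₀| + δmax) +
              48 / Real.pi * Mf * (A₀ θ * (Real.pi * Real.sqrt 2 / (B.Dtmin - κ₁))) * (K' * klScale klE0 n) * (|q₀| + δmax) *
                ((Real.pi / β) / klScale klE0 n))) := by
  have hδc : Continuous δ := hδ1.continuous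
  have hΛ := klth_klScale_pos n
  have hr₁ : 0 < klScale klE0 n / 2 := by positivity
  have hr : 0 < 4 * klScale klE0 n := by positivity
  have hcs := klfb_hasCompactSupport_of_square hAsupp
  have hint : ∀ i : MatsubaraIdx M, Integrable (klfb_integrand δ μ A f f' e' (matsubaraFreq β M i) q₀) := by
    intro i
    have hc := klfs_continuous_integrand hδc hA hlip hbd hin hout hr₁ hr hΨlip he' μ (matsubaraFreq β M i) q₀
    refine hc.integrable_of_hasCompactSupport ?_
    unfold klfb_integrand
    exact (hcs.mul_right).mul_right
  have hBi : IntegrableOn (fun θ =>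
      64 / Real.pi * MF *
            (Real.pi * Real.sqrt 2 / (B.Dtmin - κ₁) * A₁ θ / (B.Dtmin - κ₁) +
              A₀ θ * (1 / (B.Dtmin - κ₁) ^ 2 + Real.pi * Real.sqrt 2 * (2 + κ₂) / (B.Dtmin - κ₁) ^ 3)) * klScale klE0 n +
          128 / Real.pi * MF * (Real.pi * Real.sqrt 2 / (B.Dtmin - κ₁) * δA θ) +
          393216 / Real.pi * (ℓ + 8 * MF) * (A₀ θ * (Real.pi * Real.sqrt 2 / (B.Dtmin - κ₁))) * ((Real.pi / β) / klScale klE0 n) +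
            (64 / Real.pi * Mf * (A₀ θ * (Real.pi * Real.sqrt 2 / (B.Dtmin - κ₁))) * (K' * klScale klE0 n) * (|q₀| + δmax) +
              48 / Real.pi * Mf * (A₀ θ * (Real.pi * Real.sqrt 2 / (B.Dtmin - κ₁))) * (K' * klScale klE0 n) * (|q₀| + δmax) *
                ((Real.pi / β) / klScale klE0 n))) (Ioo (-π) π) := by
    have h1 : IntegrableOn (fun θ => Real.pi * Real.sqrt 2 / (B.Dtmin - κ₁) * A₁ θ / (B.Dtmin - κ₁)) (Ioo (-π) π) :=
      (hA1i.const_mul (Real.pi * Real.sqrt 2 / (B.Dtmin - κ₁))).div_const (B.Dtmin - κ₁)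
    have h2 : IntegrableOn (fun θ => A₀ θ * (1 / (B.Dtmin - κ₁) ^ 2 + Real.pi * Real.sqrt 2 * (2 + κ₂) / (B.Dtmin - κ₁) ^ 3))
        (Ioo (-π) π) := hA0i.mul_const _
    have h3 : IntegrableOn (fun θ => A₀ θ * (Real.pi * Real.sqrt 2 / (B.Dtmin - κ₁))) (Ioo (-π) π) := hA0i.mul_const _
    have h4 : IntegrableOn (fun θ => Real.pi * Real.sqrt 2 / (B.Dtmin - κ₁) * δA θ) (Ioo (-π) π) := hδAi.const_mul _
    exact (((((h1.add h2).const_mul _).mul_const _).add (h4.const_mul _)).add ((h3.const_mul _).mul_const _)).add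
      ((((h3.const_mul _).mul_const _).mul_const _).add ((((h3.const_mul _).mul_const _).mul_const _).mul_const _))
  exact klry_norm_smul_sum_integral_le_of_ray_bound_fn hint hBi fun θ hθ =>
    klfs_ray_bubble_norm_le_of_lipschitzTCQ B hδ1 hδ hκ hκ₁ hA hAsupp θ (hA0' θ) (hA1' θ) (hδA' θ) (hA0 θ hθ) (hA1 θ hθ) hκ₂ (hD2 θ) hlip hbd hin hout
      hK' hΨlip hMF hFlip hFbd hLF he' hδ0 he'δ hlo hhi q₀ hβ hn hM

end Frame

/-! ## §2 The forward slice bubble on the model carrier, per-ray quasi-Lipschitz weight data asked only inside the square -/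

section Lattice

variable {a' b' : ℝ} (B : BandBounds a' b') {δ : (Fin 2 → ℝ) → ℝ} (hδ1 : ContDiff ℝ 1 δ) {κ₀ κ₁ : ℝ}
  (hδ : ∀ k : Fin 2 → ℝ, (∀ i, |k i| ≤ π) → |δ k| ≤ κ₀)
  (hκ : ∀ k : Fin 2 → ℝ, (∀ i, |k i| ≤ π) → ‖fderiv ℝ δ k‖ ≤ κ₁) (hκ₁ : κ₁ < B.Dtmin)

include B hδ1 hδ hκ hκ₁ in
/-- **THE FORWARD SLICE BUBBLE ON `MatsubaraIdx M × TorusSite 2 L`, second line by `(K′, M′)`, WITH ANGLE-DEPENDENT QUASI-LIPSCHITZ RADIAL DATA ASKED ONLY INSIDE THE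
SQUARE**: `klfl_lattice_forward_bubble_norm_le_of_lipschitzTC_cells` with the per-ray datum `‖a(t·dir θ) − a(t'·dir θ)‖ ≤ A₁(θ)|t − t'| + δ_A(θ)` asked only for
`θ ∈ (−π, π)` and ray points INSIDE THE OPEN SQUARE (`|t cos θ|, |t sin θ| < π`) on the tube segment — the only points where the square-cut weight `a·ψ` is nonzero (off the
cut's support the difference is carried by `ψ`'s Lipschitz constant `2/zm` against the sup `A₀`).  Same conclusion. -/
theorem klfl_lattice_forward_bubble_norm_le_of_lipschitzTC_cellsSq
    {κ₂ : ℝ} (hκ₂ : 0 ≤ κ₂)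
    (hD2 : ∀ θ s t : ℝ, s ∈ Icc 0 (π / ‖dir θ‖) → t ∈ Icc 0 (π / ‖dir θ‖) →
      |fderiv ℝ δ (s • dir θ) (dir θ) - fderiv ℝ δ (t • dir θ) (dir θ)| ≤ κ₂ * |s - t|)
    {a : ℝ × ℝ → ℂ} (ha : Continuous a) (ha1 : ∀ x y, a (x + 2 * π, y) = a (x, y)) (ha2 : ∀ x y, a (x, y + 2 * π) = a (x, y))
    {A₀ La : ℝ} (hA0 : ∀ p, ‖a p‖ ≤ A₀) (hLa : ∀ p q, ‖a p - a q‖ ≤ La * dist p q)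
    {eb : ℝ × ℝ → ℝ} (hebc : Continuous eb) (heb1 : ∀ x y, eb (x + 2 * π, y) = eb (x, y)) (heb2 : ∀ x y, eb (x, y + 2 * π) = eb (x, y))
    {Le : ℝ} (hLe : ∀ p q, |eb p - eb q| ≤ Le * dist p q) {μ : ℝ} (heb : ∀ p ∈ Icc (-π) π ×ˢ Icc (-π) π, eb p = klfb_band δ μ p)
    {eb' : ℝ × ℝ → ℝ} (heb'c : Continuous eb') (heb'1 : ∀ x y, eb' (x + 2 * π, y) = eb' (x, y)) (heb'2 : ∀ x y, eb' (x, y + 2 * π) = eb' (x, y))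
    {Le' : ℝ} (hLe' : ∀ p q, |eb' p - eb' q| ≤ Le' * dist p q) {δmax : ℝ} (hδ0 : 0 ≤ δmax)
    (he'δ : ∀ p : ℝ × ℝ, |p.1| < π → |p.2| < π → |eb' p - klfb_band δ μ p| ≤ δmax)
    {zm : ℝ} (hzm : 0 < zm) {n : ℕ}
    (hzone : ∀ p ∈ Icc (-π) π ×ˢ Icc (-π) π, |eb p| < 4 * klScale klE0 n → |p.1| ≤ π - 2 * zm ∧ |p.2| ≤ π - 2 * zm)
    {A₁ δA : ℝ → ℝ} (hA1' : ∀ θ, 0 ≤ A₁ θ) (hδA' : ∀ θ, 0 ≤ δA θ)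
    (hA1i : IntegrableOn A₁ (Ioo (-π) π)) (hδAi : IntegrableOn δA (Ioo (-π) π))
    (haq : ∀ θ ∈ Ioo (-π) π, ∀ t t' : ℝ, 0 ≤ t → 0 ≤ t' →
      |t * Real.cos θ| < π → |t * Real.sin θ| < π → |t' * Real.cos θ| < π → |t' * Real.sin θ| < π →
      |klfb_band δ μ (t * Real.cos θ, t * Real.sin θ)| < 4 * klScale klE0 n →
      |klfb_band δ μ (t' * Real.cos θ, t' * Real.sin θ)| < 4 * klScale klE0 n →
      ‖a (t * Real.cos θ, t * Real.sin θ) - a (t' * Real.cos θ, t' * Real.sin θ)‖ ≤ A₁ θ * |t - t'| + δA θ)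
    {f f' : ℝ → ℂ} {Lf Mf ℓf LF MF ℓ : ℝ}
    (hlip : ∀ s s', ‖f s - f s'‖ ≤ Lf * |s - s'|) (hbd : ∀ s, ‖f s‖ ≤ Mf) (hLf : Lf ≤ ℓf / klScale klE0 n ^ 2)
    (hin : ∀ s, s ≤ (klScale klE0 n / 2) ^ 2 → f s = 0) (hout : ∀ s, (4 * klScale klE0 n) ^ 2 ≤ s → f s = 0)
    {K' M' : ℝ} (hK' : 0 ≤ K') (hΨlip : ∀ k₀ e k₀' e', ‖klfb_prop f' k₀ e - klfb_prop f' k₀' e'‖ ≤ K' * (|k₀ - k₀'| + |e - e'|))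
    (hM' : ∀ k₀ e, ‖klfb_prop f' k₀ e‖ ≤ M')
    (hMF : 0 ≤ MF) (hFlip : ∀ s s', ‖f s * f' s - f s' * f' s'‖ ≤ LF * |s - s'|) (hFbd : ∀ s, ‖f s * f' s‖ ≤ MF)
    (hLF : LF ≤ ℓ / klScale klE0 n ^ 2)
    (hlo : a' < μ - 4 * klScale klE0 n - κ₀) (hhi : μ + 4 * klScale klE0 n + κ₀ < b')
    (q₀ : ℝ) {β : ℝ} (hβ : klBetaMin ≤ β) (hn : n ≤ nScales β + 1) {M : ℕ}
    (hM : β * (4 * klScale klE0 n) / (2 * Real.pi) + 1 ≤ M) (L : ℕ) [NeZero L] :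
    ‖β⁻¹ • ∑ i : MatsubaraIdx M, ((L ^ 2 : ℕ) : ℝ)⁻¹ • ∑ k : TorusSite 2 L,
        a (latticeMomentum L k 0, latticeMomentum L k 1) *
          klfb_prop f (matsubaraFreq β M i) (eb (latticeMomentum L k 0, latticeMomentum L k 1)) *
            klfb_prop f' (matsubaraFreq β M i + q₀) (eb' (latticeMomentum L k 0, latticeMomentum L k 1))‖ ≤
      ((2 * π) ^ 2)⁻¹ *
          (∫ θ in Ioo (-π) π,
            (64 / Real.pi * MF *
                (Real.pi * Real.sqrt 2 / (B.Dtmin - κ₁) * (A₁ θ + A₀ * (2 / zm)) / (B.Dtmin - κ₁) +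
                  A₀ * (1 / (B.Dtmin - κ₁) ^ 2 + Real.pi * Real.sqrt 2 * (2 + κ₂) / (B.Dtmin - κ₁) ^ 3)) * klScale klE0 n +
              128 / Real.pi * MF * (Real.pi * Real.sqrt 2 / (B.Dtmin - κ₁) * δA θ) +
              393216 / Real.pi * (ℓ + 8 * MF) * (A₀ * (Real.pi * Real.sqrt 2 / (B.Dtmin - κ₁))) * ((Real.pi / β) / klScale klE0 n) +
              (64 / Real.pi * Mf * (A₀ * (Real.pi * Real.sqrt 2 / (B.Dtmin - κ₁))) * (K' * klScale klE0 n) * (|q₀| + δmax) +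
                48 / Real.pi * Mf * (A₀ * (Real.pi * Real.sqrt 2 / (B.Dtmin - κ₁))) * (K' * klScale klE0 n) * (|q₀| + δmax) *
                  ((Real.pi / β) / klScale klE0 n)))) +
        32 * klScale klE0 n *
            (La * (2 * Mf / klScale klE0 n) * M' +
              A₀ * ((9 * ℓf + 4 * Mf) / klScale klE0 n ^ 2 * Le) * M' +
              A₀ * (2 * Mf / klScale klE0 n) * (K' * Le')) / L := by
  have hΛ := klth_klScale_pos n
  have hr₁ : 0 < klScale klE0 n / 2 := by positivity
  have hr : 0 < 4 * klScale klE0 n := by positivity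
  have hA0' : 0 ≤ A₀ := (norm_nonneg _).trans (hA0 0)
  have hd10 : (0 : ℝ) < dist ((1 : ℝ), (0 : ℝ)) ((0 : ℝ), (0 : ℝ)) := by rw [Prod.dist_eq]; simp
  have hLa0 : 0 ≤ La := nonneg_of_mul_nonneg_left ((norm_nonneg _).trans (hLa (1, 0) (0, 0))) hd10
  have hLe0 : 0 ≤ Le := nonneg_of_mul_nonneg_left ((abs_nonneg _).trans (hLe (1, 0) (0, 0))) hd10
  have hLe'0 : 0 ≤ Le' := nonneg_of_mul_nonneg_left ((abs_nonneg _).trans (hLe' (1, 0) (0, 0))) hd10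
  have hMf : 0 ≤ Mf := (norm_nonneg _).trans (hbd 0)
  have hM'0 : 0 ≤ M' := (norm_nonneg _).trans (hM' 0 0)
  have hℓf : 0 ≤ 9 * ℓf + 4 * Mf := by
    have hLf0 : 0 ≤ Lf := by have := hlip 0 1; norm_num at this; linarith [norm_nonneg (f 0 - f 1)]
    have : 0 ≤ ℓf := by
      have h := hLf0.trans hLf; rwa [le_div_iff₀ (by positivity), zero_mul] at h
    positivity
  -- the planar weight `A = a·ψ`
  set A : ℝ × ℝ → ℂ := fun p => a p * (klfl_squareCut zm p : ℂ) with hAdef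
  have hψbd : ∀ p, ‖(klfl_squareCut zm p : ℂ)‖ ≤ 1 := fun p => by
    rw [Complex.norm_real, Real.norm_of_nonneg (klfl_squareCut_mem zm p).1]; exact (klfl_squareCut_mem zm p).2
  have hAc : Continuous A := ha.mul (Complex.continuous_ofReal.comp (klfl_continuous_squareCut zm))
  have hAsupp : ∀ p : ℝ × ℝ, A p ≠ 0 → |p.1| < π ∧ |p.2| < π := by
    intro p hp
    have hψ : klfl_squareCut zm p ≠ 0 := fun h0 => hp (by simp only [hAdef, h0, Complex.ofReal_zero, mul_zero])
    obtain ⟨h1, h2⟩ := klfl_abs_lt_of_squareCut_ne_zero hzm hψ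
    exact ⟨by linarith, by linarith⟩
  have hAbd : ∀ p, ‖A p‖ ≤ A₀ := fun p => by
    simp only [hAdef]; rw [norm_mul]
    calc ‖a p‖ * ‖(klfl_squareCut zm p : ℂ)‖ ≤ A₀ * 1 := mul_le_mul (hA0 p) (hψbd p) (norm_nonneg _) hA0'
      _ = A₀ := mul_one _
  have hψzero : ∀ p : ℝ × ℝ, ¬ (|p.1| < π - zm ∧ |p.2| < π - zm) → klfl_squareCut zm p = 0 := fun p hp => by
    by_contra h0
    exact hp (klfl_abs_lt_of_squareCut_ne_zero hzm h0)
  have hArad : ∀ θ ∈ Ioo (-π) π, ∀ t t' : ℝ, 0 ≤ t → 0 ≤ t' → |klfb_band δ μ (t * Real.cos θ, t * Real.sin θ)| < 4 * klScale klE0 n →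
      |klfb_band δ μ (t' * Real.cos θ, t' * Real.sin θ)| < 4 * klScale klE0 n →
      ‖A (t * Real.cos θ, t * Real.sin θ) - A (t' * Real.cos θ, t' * Real.sin θ)‖ ≤ (A₁ θ + A₀ * (2 / zm)) * |t - t'| + δA θ := by
    intro θ hθ t t' ht ht' hb hb'
    set x := (t * Real.cos θ, t * Real.sin θ) with hx
    set y := (t' * Real.cos θ, t' * Real.sin θ) with hy
    have hd : dist x y ≤ |t - t'| := klfl_dist_ray_le θ t t'
    have hA1θ := hA1' θ
    have hδAθ := hδA' θ
    have hψlip : |klfl_squareCut zm x - klfl_squareCut zm y| ≤ 2 / zm * |t - t'| :=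
      (klfl_squareCut_lipschitz hzm x y).trans (mul_le_mul_of_nonneg_left hd (by positivity))
    -- the far cases: one of the two points is off the cut's support
    have hfar : klfl_squareCut zm x = 0 ∨ klfl_squareCut zm y = 0 →
        ‖A x - A y‖ ≤ (A₁ θ + A₀ * (2 / zm)) * |t - t'| + δA θ := by
      intro hxy
      have hcore : ‖A x - A y‖ ≤ A₀ * (2 / zm * |t - t'|) := by
        rcases hxy with h0 | h0
        · have hAx : A x = 0 := by simp only [hAdef, h0, Complex.ofReal_zero, mul_zero]
          rw [hAx, zero_sub, norm_neg]
          simp only [hAdef]; rw [norm_mul, Complex.norm_real, Real.norm_of_nonneg (klfl_squareCut_mem zm y).1]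
          have hψy : klfl_squareCut zm y ≤ 2 / zm * |t - t'| := by
            have := (abs_sub_comm (klfl_squareCut zm x) (klfl_squareCut zm y)) ▸ hψlip
            rw [h0, sub_zero, abs_of_nonneg (klfl_squareCut_mem zm y).1] at this; exact this
          exact mul_le_mul (hA0 y) hψy (klfl_squareCut_mem zm y).1 hA0'
        · have hAy : A y = 0 := by simp only [hAdef, h0, Complex.ofReal_zero, mul_zero]
          rw [hAy, sub_zero]
          simp only [hAdef]; rw [norm_mul, Complex.norm_real, Real.norm_of_nonneg (klfl_squareCut_mem zm x).1]
          have hψx : klfl_squareCut zm x ≤ 2 / zm * |t - t'| := by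
            have := hψlip
            rw [h0, sub_zero, abs_of_nonneg (klfl_squareCut_mem zm x).1] at this; exact this
          exact mul_le_mul (hA0 x) hψx (klfl_squareCut_mem zm x).1 hA0'
      calc ‖A x - A y‖ ≤ A₀ * (2 / zm * |t - t'|) := hcore
        _ ≤ (A₁ θ + A₀ * (2 / zm)) * |t - t'| + δA θ := by nlinarith [abs_nonneg (t - t')]
    by_cases hxin : |x.1| < π - zm ∧ |x.2| < π - zm
    · by_cases hyin : |y.1| < π - zm ∧ |y.2| < π - zm
      · -- both points strictly inside the square: the per-ray datum of `a`
        have hx1 : |t * Real.cos θ| < π := by have := hxin.1; simp only [hx] at this; linarith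
        have hx2 : |t * Real.sin θ| < π := by have := hxin.2; simp only [hx] at this; linarith
        have hy1 : |t' * Real.cos θ| < π := by have := hyin.1; simp only [hy] at this; linarith
        have hy2 : |t' * Real.sin θ| < π := by have := hyin.2; simp only [hy] at this; linarith
        have hsplit : A x - A y = (a x - a y) * (klfl_squareCut zm x : ℂ) + a y * ((klfl_squareCut zm x : ℂ) - (klfl_squareCut zm y : ℂ)) := by
          simp only [hAdef]; ring
        rw [hsplit]
        have h1 : ‖(a x - a y) * (klfl_squareCut zm x : ℂ)‖ ≤ (A₁ θ * |t - t'| + δA θ) * 1 := by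
          rw [norm_mul]
          exact mul_le_mul (haq θ hθ t t' ht ht' hx1 hx2 hy1 hy2 hb hb') (hψbd x) (norm_nonneg _) (by positivity)
        have h2 : ‖a y * ((klfl_squareCut zm x : ℂ) - (klfl_squareCut zm y : ℂ))‖ ≤ A₀ * (2 / zm * |t - t'|) := by
          rw [norm_mul, ← Complex.ofReal_sub, Complex.norm_real, Real.norm_eq_abs]
          exact mul_le_mul (hA0 y) hψlip (abs_nonneg _) hA0'
        calc _ ≤ ‖(a x - a y) * (klfl_squareCut zm x : ℂ)‖ + ‖a y * ((klfl_squareCut zm x : ℂ) - (klfl_squareCut zm y : ℂ))‖ := norm_add_le _ _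
          _ ≤ (A₁ θ * |t - t'| + δA θ) * 1 + A₀ * (2 / zm * |t - t'|) := add_le_add h1 h2
          _ = (A₁ θ + A₀ * (2 / zm)) * |t - t'| + δA θ := by ring
      · exact hfar (Or.inr (hψzero y hyin))
    · exact hfar (Or.inl (hψzero x hxin))
  -- the planar bound
  have hA1s' : ∀ θ, 0 ≤ A₁ θ + A₀ * (2 / zm) := fun θ => by have := hA1' θ; positivity
  have hvol : volume (Ioo (-π) π) < ⊤ := by rw [Real.volume_Ioo]; exact ENNReal.ofReal_lt_top
  have hA1si : IntegrableOn (fun θ => A₁ θ + A₀ * (2 / zm)) (Ioo (-π) π) := hA1i.add (integrableOn_const (hs := hvol.ne))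
  have hB := klfs_planar_bubble_norm_le_of_lipschitzTCQ_Ioo B hδ1 hδ hκ hκ₁ hAc hAsupp (A₀ := fun _ => A₀) (fun _ => hA0') hA1s' hδA'
    (integrableOn_const (hs := hvol.ne)) hA1si hδAi (fun θ _ t _ _ => hAbd _) hArad hκ₂ hD2 hlip hbd hin hout hK' hΨlip
    hMF hFlip hFbd hLF heb'c hδ0 he'δ hlo hhi q₀ hβ hn hM
  -- the periodic family and its properties
  set F : MatsubaraIdx M → ℝ × ℝ → ℂ := fun i p =>
    a p * klfb_prop f (matsubaraFreq β M i) (eb p) * klfb_prop f' (matsubaraFreq β M i + q₀) (eb' p) with hFdef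
  have hΦc : ∀ k₀, Continuous fun e => klfb_prop f k₀ e := fun k₀ => klfb_continuous_prop_snd hlip hbd hin hout hr₁ hr k₀
  have hΨc : ∀ k₀, Continuous fun e => klfb_prop f' k₀ e := fun k₀ => klfs_continuous_snd_of_lipschitz hΨlip k₀
  have hFc : ∀ i, Continuous (F i) := fun i => (ha.mul ((hΦc _).comp hebc)).mul ((hΨc _).comp heb'c)
  have hF1 : ∀ i x y, F i (x + 2 * π, y) = F i (x, y) := fun i x y => by simp only [hFdef, ha1, heb1, heb'1]
  have hF2 : ∀ i x y, F i (x, y + 2 * π) = F i (x, y) := fun i x y => by simp only [hFdef, ha2, heb2, heb'2]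
  set K : ℝ := La * (2 * Mf / klScale klE0 n) * M' +
    A₀ * ((9 * ℓf + 4 * Mf) / klScale klE0 n ^ 2 * Le) * M' +
    A₀ * (2 * Mf / klScale klE0 n) * (K' * Le') with hKdef
  have hK0 : 0 ≤ K := by rw [hKdef]; positivity
  have hFlip' : ∀ i (p q : ℝ × ℝ), ‖F i p - F i q‖ ≤ (K.toNNReal : ℝ) * dist p q := by
    intro i p q
    rw [Real.coe_toNNReal _ hK0]
    have hv : ∀ p q : ℝ × ℝ, ‖klfb_prop f (matsubaraFreq β M i) (eb p) - klfb_prop f (matsubaraFreq β M i) (eb q)‖ ≤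
        (9 * ℓf + 4 * Mf) / klScale klE0 n ^ 2 * Le * dist p q :=
      fun p q => (klfl_prop_lipschitz_snd hlip hbd hLf hin hout (matsubaraFreq β M i) (eb p) (eb q)).trans (by
        rw [mul_assoc]; exact mul_le_mul_of_nonneg_left (hLe p q) (by positivity))
    have hw : ∀ p q : ℝ × ℝ, ‖klfb_prop f' (matsubaraFreq β M i + q₀) (eb' p) - klfb_prop f' (matsubaraFreq β M i + q₀) (eb' q)‖ ≤
        K' * Le' * dist p q := by
      intro p q
      have h := hΨlip (matsubaraFreq β M i + q₀) (eb' p) (matsubaraFreq β M i + q₀) (eb' q)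
      rw [sub_self, abs_zero, zero_add] at h
      refine h.trans ?_
      rw [mul_assoc]; exact mul_le_mul_of_nonneg_left (hLe' p q) hK'
    exact klfl_lipschitz_triple (u := a) (v := fun p => klfb_prop f (matsubaraFreq β M i) (eb p))
      (w := fun p => klfb_prop f' (matsubaraFreq β M i + q₀) (eb' p))
      hA0 (fun p => klfl_prop_norm_le hbd hin (matsubaraFreq β M i) (eb p))
      (fun p => hM' (matsubaraFreq β M i + q₀) (eb' p)) hLa hv hw p q
  have hFh : ∀ i, ∀ p ∈ Icc (-π) π ×ˢ Icc (-π) π, F i p = klfb_integrand δ μ A f f' eb' (matsubaraFreq β M i) q₀ p :=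
    fun i p hp => klfl_integrand_eq_on_square hzm heb hzone hout (matsubaraFreq β M i) q₀ hp
  have hh0 : ∀ i, ∀ p ∉ Icc (-π) π ×ˢ Icc (-π) π, klfb_integrand δ μ A f f' eb' (matsubaraFreq β M i) q₀ p = 0 :=
    fun i p hp => klfl_integrand_eq_zero_off_square hzm (matsubaraFreq β M i) q₀ hp
  have hzero : ∀ i, 4 * klScale klE0 n ≤ |matsubaraFreq β M i| → ∀ p, F i p = 0 := by
    intro i hi p
    simp only [hFdef]
    rw [klfl_prop_eq_zero_of_le_abs_fst hout hi, mul_zero, zero_mul]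
  have h := klfl_matsubara_latticeAverage_norm_le_scale (F := F) (h := fun i => klfb_integrand δ μ A f f' eb' (matsubaraFreq β M i) q₀)
    hβ hn hFc hF1 hF2 hFlip' hFh hh0 hzero hB L
  rw [Real.coe_toNNReal _ hK0] at h
  exact h

end Lattice

/-! ## §3 The soft partner on the lattice -/

section Soft

variable {a' b' : ℝ} (B : BandBounds a' b') {δ : (Fin 2 → ℝ) → ℝ} (hδ1 : ContDiff ℝ 1 δ) {κ₀ κ₁ : ℝ}
  (hδ : ∀ k : Fin 2 → ℝ, (∀ i, |k i| ≤ π) → |δ k| ≤ κ₀)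
  (hκ : ∀ k : Fin 2 → ℝ, (∀ i, |k i| ≤ π) → ‖fderiv ℝ δ k‖ ≤ κ₁) (hκ₁ : κ₁ < B.Dtmin)

include B hδ1 hδ hκ hκ₁ in
/-- **THE FORWARD SLICE BUBBLE ON THE MODEL CARRIER WITH A SOFT PARTNER, per-ray quasi-Lipschitz weight data asked only inside the square**: `klfl_lattice_soft_bubble_norm_leTC_cells`
with the per-ray datum restricted to `θ ∈ (−π, π)` and ray points in the open square; conclusion at `K′ = (3ℓ' + 512M_f')/Λₙ²`, `M′ = 16M_f'/Λₙ`. -/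
theorem klfl_lattice_soft_bubble_norm_leTC_cellsSq
    {κ₂ : ℝ} (hκ₂ : 0 ≤ κ₂)
    (hD2 : ∀ θ s t : ℝ, s ∈ Icc 0 (π / ‖dir θ‖) → t ∈ Icc 0 (π / ‖dir θ‖) →
      |fderiv ℝ δ (s • dir θ) (dir θ) - fderiv ℝ δ (t • dir θ) (dir θ)| ≤ κ₂ * |s - t|)
    {a : ℝ × ℝ → ℂ} (ha : Continuous a) (ha1 : ∀ x y, a (x + 2 * π, y) = a (x, y)) (ha2 : ∀ x y, a (x, y + 2 * π) = a (x, y))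
    {A₀ La : ℝ} (hA0 : ∀ p, ‖a p‖ ≤ A₀) (hLa : ∀ p q, ‖a p - a q‖ ≤ La * dist p q)
    {eb : ℝ × ℝ → ℝ} (hebc : Continuous eb) (heb1 : ∀ x y, eb (x + 2 * π, y) = eb (x, y)) (heb2 : ∀ x y, eb (x, y + 2 * π) = eb (x, y))
    {Le : ℝ} (hLe : ∀ p q, |eb p - eb q| ≤ Le * dist p q) {μ : ℝ} (heb : ∀ p ∈ Icc (-π) π ×ˢ Icc (-π) π, eb p = klfb_band δ μ p)
    {eb' : ℝ × ℝ → ℝ} (heb'c : Continuous eb') (heb'1 : ∀ x y, eb' (x + 2 * π, y) = eb' (x, y)) (heb'2 : ∀ x y, eb' (x, y + 2 * π) = eb' (x, y))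
    {Le' : ℝ} (hLe' : ∀ p q, |eb' p - eb' q| ≤ Le' * dist p q) {δmax : ℝ} (hδ0 : 0 ≤ δmax) {n : ℕ}
    (hδmax : δmax ≤ klScale klE0 n / 8) (hshift : ∀ p : ℝ × ℝ, |eb' p - eb p| ≤ δmax)
    {zm : ℝ} (hzm : 0 < zm)
    (hzone : ∀ p ∈ Icc (-π) π ×ˢ Icc (-π) π, |eb p| < 4 * klScale klE0 n → |p.1| ≤ π - 2 * zm ∧ |p.2| ≤ π - 2 * zm)
    {A₁ δA : ℝ → ℝ} (hA1' : ∀ θ, 0 ≤ A₁ θ) (hδA' : ∀ θ, 0 ≤ δA θ)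
    (hA1i : IntegrableOn A₁ (Ioo (-π) π)) (hδAi : IntegrableOn δA (Ioo (-π) π))
    (haq : ∀ θ ∈ Ioo (-π) π, ∀ t t' : ℝ, 0 ≤ t → 0 ≤ t' →
      |t * Real.cos θ| < π → |t * Real.sin θ| < π → |t' * Real.cos θ| < π → |t' * Real.sin θ| < π →
      |klfb_band δ μ (t * Real.cos θ, t * Real.sin θ)| < 4 * klScale klE0 n →
      |klfb_band δ μ (t' * Real.cos θ, t' * Real.sin θ)| < 4 * klScale klE0 n →
      ‖a (t * Real.cos θ, t * Real.sin θ) - a (t' * Real.cos θ, t' * Real.sin θ)‖ ≤ A₁ θ * |t - t'| + δA θ)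
    {f f' : ℝ → ℂ} {Lf Mf ℓf Lf' Mf' ℓ' LF MF ℓ : ℝ}
    (hlip : ∀ s s', ‖f s - f s'‖ ≤ Lf * |s - s'|) (hbd : ∀ s, ‖f s‖ ≤ Mf) (hLf : Lf ≤ ℓf / klScale klE0 n ^ 2)
    (hin : ∀ s, s ≤ (klScale klE0 n / 2) ^ 2 → f s = 0) (hout : ∀ s, (4 * klScale klE0 n) ^ 2 ≤ s → f s = 0)
    (hlip' : ∀ s s', ‖f' s - f' s'‖ ≤ Lf' * |s - s'|) (hbd' : ∀ s, ‖f' s‖ ≤ Mf') (hLf' : Lf' ≤ ℓ' / klScale klE0 n ^ 2)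
    (hMF : 0 ≤ MF) (hFlip : ∀ s s', ‖f s * f' s - f s' * f' s'‖ ≤ LF * |s - s'|) (hFbd : ∀ s, ‖f s * f' s‖ ≤ MF)
    (hLF : LF ≤ ℓ / klScale klE0 n ^ 2)
    (hlo : a' < μ - 4 * klScale klE0 n - κ₀) (hhi : μ + 4 * klScale klE0 n + κ₀ < b')
    {q₀ : ℝ} (hq₀ : |q₀| ≤ klScale klE0 n / 8) {β : ℝ} (hβ : klBetaMin ≤ β) (hn : n ≤ nScales β + 1) {M : ℕ}
    (hM : β * (4 * klScale klE0 n) / (2 * Real.pi) + 1 ≤ M) (L : ℕ) [NeZero L] :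
    ‖β⁻¹ • ∑ i : MatsubaraIdx M, ((L ^ 2 : ℕ) : ℝ)⁻¹ • ∑ k : TorusSite 2 L,
        a (latticeMomentum L k 0, latticeMomentum L k 1) *
          klfb_prop f (matsubaraFreq β M i) (eb (latticeMomentum L k 0, latticeMomentum L k 1)) *
            klfb_prop f' (matsubaraFreq β M i + q₀) (eb' (latticeMomentum L k 0, latticeMomentum L k 1))‖ ≤
      ((2 * π) ^ 2)⁻¹ *
          (∫ θ in Ioo (-π) π,
            (64 / Real.pi * MF *
                (Real.pi * Real.sqrt 2 / (B.Dtmin - κ₁) * (A₁ θ + A₀ * (2 / zm)) / (B.Dtmin - κ₁) +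
                  A₀ * (1 / (B.Dtmin - κ₁) ^ 2 + Real.pi * Real.sqrt 2 * (2 + κ₂) / (B.Dtmin - κ₁) ^ 3)) * klScale klE0 n +
              128 / Real.pi * MF * (Real.pi * Real.sqrt 2 / (B.Dtmin - κ₁) * δA θ) +
              393216 / Real.pi * (ℓ + 8 * MF) * (A₀ * (Real.pi * Real.sqrt 2 / (B.Dtmin - κ₁))) * ((Real.pi / β) / klScale klE0 n) +
              (64 / Real.pi * Mf * (A₀ * (Real.pi * Real.sqrt 2 / (B.Dtmin - κ₁))) *
                ((3 * ℓ' + 512 * Mf') / klScale klE0 n ^ 2 * klScale klE0 n) * (|q₀| + δmax) +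
                48 / Real.pi * Mf * (A₀ * (Real.pi * Real.sqrt 2 / (B.Dtmin - κ₁))) *
                ((3 * ℓ' + 512 * Mf') / klScale klE0 n ^ 2 * klScale klE0 n) * (|q₀| + δmax) * ((Real.pi / β) / klScale klE0 n)))) +
        32 * klScale klE0 n *
            (La * (2 * Mf / klScale klE0 n) * (16 * Mf' / klScale klE0 n) +
              A₀ * ((9 * ℓf + 4 * Mf) / klScale klE0 n ^ 2 * Le) * (16 * Mf' / klScale klE0 n) +
              A₀ * (2 * Mf / klScale klE0 n) * ((3 * ℓ' + 512 * Mf') / klScale klE0 n ^ 2 * Le')) / L := by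
  have hΛ := klth_klScale_pos n
  have hMf' : 0 ≤ Mf' := (norm_nonneg _).trans (hbd' 0)
  have hLf'0 : 0 ≤ Lf' := by have := hlip' 0 1; norm_num at this; linarith [norm_nonneg (f' 0 - f' 1)]
  have hℓ' : 0 ≤ ℓ' := by have h := hLf'0.trans hLf'; rwa [le_div_iff₀ (by positivity), zero_mul] at h
  have he'δ : ∀ p : ℝ × ℝ, |p.1| < π → |p.2| < π → |eb' p - klfb_band δ μ p| ≤ δmax := by
    intro p h1 h2
    rw [← heb p ⟨⟨(abs_lt.mp h1).1.le, (abs_lt.mp h1).2.le⟩, ⟨(abs_lt.mp h2).1.le, (abs_lt.mp h2).2.le⟩⟩]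
    exact hshift p
  have hcut : ∀ (i : MatsubaraIdx M) (k : TorusSite 2 L),
      a (latticeMomentum L k 0, latticeMomentum L k 1) *
          klfb_prop f (matsubaraFreq β M i) (eb (latticeMomentum L k 0, latticeMomentum L k 1)) *
            klfb_prop f' (matsubaraFreq β M i + q₀) (eb' (latticeMomentum L k 0, latticeMomentum L k 1)) =
        a (latticeMomentum L k 0, latticeMomentum L k 1) *
          klfb_prop f (matsubaraFreq β M i) (eb (latticeMomentum L k 0, latticeMomentum L k 1)) *
            klfb_prop (fun s => f' s * (klfp_cut (klScale klE0 n) s : ℂ)) (matsubaraFreq β M i + q₀)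
              (eb' (latticeMomentum L k 0, latticeMomentum L k 1)) :=
    fun i k => klfl_summand_cut_eq hin hq₀ ((hshift _).trans hδmax)
  simp_rw [hcut]
  have hK' : 0 ≤ (3 * ℓ' + 512 * Mf') / klScale klE0 n ^ 2 := by positivity
  have hFlip'' : ∀ s s', ‖f s * (f' s * (klfp_cut (klScale klE0 n) s : ℂ)) - f s' * (f' s' * (klfp_cut (klScale klE0 n) s' : ℂ))‖ ≤
      LF * |s - s'| := fun s s' => by rw [klfp_mul_cutWeight_eq hin s, klfp_mul_cutWeight_eq hin s']; exact hFlip s s'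
  have hFbd'' : ∀ s, ‖f s * (f' s * (klfp_cut (klScale klE0 n) s : ℂ))‖ ≤ MF := fun s => by
    rw [klfp_mul_cutWeight_eq hin s]; exact hFbd s
  exact klfl_lattice_forward_bubble_norm_le_of_lipschitzTC_cellsSq B hδ1 hδ hκ hκ₁ hκ₂ hD2 ha ha1 ha2 hA0 hLa hebc heb1 heb2 hLe heb heb'c heb'1 heb'2
    hLe' hδ0 he'δ hzm hzone hA1' hδA' hA1i hδAi haq hlip hbd hLf hin hout hK' (klfp_prop_cutWeight_lipschitz_path hlip' hbd' hLf')
    (klfl_prop_cutWeight_norm_le hbd') hMF hFlip'' hFbd'' hLF hlo hhi q₀ hβ hn hM L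

end Soft

end Summit.HubbardSuperconductivity.HubbardSuperconductivity.Theorems.KLRegimeSplit

end
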